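import Summits.ResolutionOfSingularities.ResolutionOfSingularities.Theses.RuledResidues
import HarnessLib

/-!
# Attractor of a contracted-divisor orbit: contact growth along an invariant prime
(crux `RuledResidues.NonRuledDivisors`, stmt-ResolutionOfSingularities-18075; line `contracted-divisor`;
crux idea `Cruxes/NonRuledDivisors/Ideas/attractor-obstruction.md`, Claim B, step 2 — its algebraic core)

Setting of line `contracted-divisor`: a ring automorphism `τ` of `K` with `τ A ⊆ A` for a subring `A`
(think `A = R_P` completed or not), an element `g ∈ A` with `τ(𝔪)A = gA` of UNIT MULTIPLIER
(`τ g = g·u`, `u ∈ Aˣ`), and a prime `𝔭` of `A` not containing `g` which is `τ`-invariant and contracted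
into `(g)` (`τ 𝔭 ⊆ 𝔭 ∩ gA`; in the card `𝔭 = 𝔭₀` is the ideal of the FIXED ARC of the Kato datum).  Then
`τⁿ 𝔭 ⊆ gⁿ 𝔭` (`attractor_pow_apply_mem`), `τⁿ g = g·(unit)` (`attractor_pow_apply_generator`), and
consequently every place of the orbit `D.comap τⁿ` of a valuation ring `D ⊇ A` has CONTACT `≥ n` with
`𝔭` measured against `g`: `f / gⁿ ∈ D.comap τⁿ` for all `f ∈ 𝔭` (`attractor_contact`).  This is the
mechanism by which the orbit of line C converges, in the `k((g))`-analytic generic fibre, to the fixed arc —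
the resolution-free half of the attractor obstruction (the other half, smoothness at the arc ⇒ ruledness, is
analytic and not formalised).  Pure commutative algebra; no finiteness, Noetherian or characteristic input.
-/

-- dupNamespace: the problem namespace legitimately repeats the summit name
set_option linter.dupNamespace false

namespace Summit.ResolutionOfSingularities.ResolutionOfSingularities.Theorems

variable {K : Type*} [Field K]

/-- Iterates of a ring automorphism: `τⁿ⁺¹ x = τ (τⁿ x)`. [folklore] -/
theorem ringAut_pow_succ_apply (τ : K ≃+* K) (n : ℕ) (x : K) :
    (τ ^ (n + 1)) x = τ ((τ ^ n) x) := by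
  rw [pow_succ']
  rfl

/-- From `τ 𝔭 ⊆ 𝔭`, `τ 𝔭 ⊆ g·A`, `𝔭` prime and `g ∉ 𝔭`: `τ 𝔭 ⊆ g·𝔭` (the form used below). [folklore] -/
theorem attractor_contracted_of_invariant (A : Subring K) (τ : K ≃+* K) (g : A) (𝔭 : Ideal A)
    [𝔭.IsPrime] (hg𝔭 : g ∉ 𝔭)
    (hinv : ∀ f : A, f ∈ 𝔭 → ∃ b : A, b ∈ 𝔭 ∧ τ (f : K) = (b : K))
    (hcon : ∀ f : A, f ∈ 𝔭 → ∃ a : A, τ (f : K) = (g : K) * (a : K)) :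
    ∀ f : A, f ∈ 𝔭 → ∃ a : A, a ∈ 𝔭 ∧ τ (f : K) = (g : K) * (a : K) := by
  intro f hf
  obtain ⟨b, hb, hbeq⟩ := hinv f hf
  obtain ⟨a, haeq⟩ := hcon f hf
  refine ⟨a, ?_, haeq⟩
  have hba : b = g * a := by
    apply Subtype.ext
    rw [← hbeq, haeq]
    rfl
  rw [hba] at hb
  exact ((Ideal.IsPrime.mem_or_mem ‹𝔭.IsPrime› hb).resolve_left hg𝔭)

/-- **Contact growth, ideal form.**  If `τ A ⊆ A`, `τ g = g·u` with `u ∈ A`, and `τ 𝔭 ⊆ g·𝔭` for an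
ideal `𝔭` of `A`, then `τⁿ f ∈ gⁿ·𝔭` for every `f ∈ 𝔭` and every `n`. [folklore] -/
theorem attractor_pow_apply_mem (A : Subring K) (τ : K ≃+* K)
    (g u : A) (hτg : τ (g : K) = (g : K) * (u : K)) (𝔭 : Ideal A)
    (hcon : ∀ f : A, f ∈ 𝔭 → ∃ a : A, a ∈ 𝔭 ∧ τ (f : K) = (g : K) * (a : K)) :
    ∀ (n : ℕ) (f : A), f ∈ 𝔭 → ∃ a : A, a ∈ 𝔭 ∧ (τ ^ n) (f : K) = (g : K) ^ n * (a : K) := by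
  intro n
  induction n with
  | zero =>
    intro f hf
    exact ⟨f, hf, by simp⟩
  | succ n ih =>
    intro f hf
    obtain ⟨a, ha, haeq⟩ := ih f hf
    obtain ⟨a', ha', ha'eq⟩ := hcon a ha
    refine ⟨u ^ n * a', Ideal.mul_mem_left 𝔭 _ ha', ?_⟩
    rw [ringAut_pow_succ_apply, haeq, map_mul, map_pow, hτg, ha'eq]
    push_cast
    ring

/-- **The generator stays a generator up to a unit**: `τⁿ g = g·w` with `w` a unit of `A`. [folklore] -/
theorem attractor_pow_apply_generator (A : Subring K) (τ : K ≃+* K) (hτA : ∀ a : K, a ∈ A → τ a ∈ A)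
    (g u : A) (hu : IsUnit u) (hτg : τ (g : K) = (g : K) * (u : K)) :
    ∀ n : ℕ, ∃ w : A, IsUnit w ∧ (τ ^ n) (g : K) = (g : K) * (w : K) := by
  intro n
  induction n with
  | zero => exact ⟨1, isUnit_one, by simp⟩
  | succ n ih =>
    obtain ⟨w, hw, hweq⟩ := ih
    obtain ⟨w', hw'⟩ := hw.exists_right_inv
    -- `τ w` is again a unit of `A`
    let τw : A := ⟨τ (w : K), hτA _ w.2⟩
    let τw' : A := ⟨τ (w' : K), hτA _ w'.2⟩
    have hτw : IsUnit τw := by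
      refine IsUnit.of_mul_eq_one τw' ?_
      apply Subtype.ext
      change τ (w : K) * τ (w' : K) = 1
      rw [← map_mul, ← Subring.coe_mul, hw', Subring.coe_one, map_one]
    refine ⟨u * τw, hu.mul hτw, ?_⟩
    rw [ringAut_pow_succ_apply, hweq, map_mul, hτg]
    push_cast
    change (g : K) * (u : K) * τ (w : K) = (g : K) * ((u : K) * τ (w : K))
    ring

/-- **Contact growth, valuative form (Claim B, step 2 of `Ideas/attractor-obstruction.md`).**  Under the
hypotheses above, for every valuation ring `D ⊇ A` of `K`, every `n`, and every `f ∈ 𝔭`, the place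
`D.comap τⁿ` of the orbit contains `f·g⁻ⁿ`: its value of `f` is at least `n` times its value of `g`.  In the
card, `𝔭` is the ideal of the fixed formal arc and this says the orbit converges to the arc in the
`k((g))`-analytic generic fibre. [folklore] -/
theorem attractor_contact (A : Subring K) (τ : K ≃+* K) (hτA : ∀ a : K, a ∈ A → τ a ∈ A)
    (g u : A) (hu : IsUnit u) (hg0 : (g : K) ≠ 0) (hτg : τ (g : K) = (g : K) * (u : K))
    (𝔭 : Ideal A) (hcon : ∀ f : A, f ∈ 𝔭 → ∃ a : A, a ∈ 𝔭 ∧ τ (f : K) = (g : K) * (a : K))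
    (D : ValuationSubring K) (hAD : A ≤ D.toSubring) :
    ∀ (n : ℕ) (f : A), f ∈ 𝔭 →
      (f : K) * ((g : K)⁻¹) ^ n ∈ (D.comap ((τ ^ n : K ≃+* K) : K →+* K)) := by
  intro n f hf
  obtain ⟨a, -, haeq⟩ := attractor_pow_apply_mem A τ g u hτg 𝔭 hcon n f hf
  obtain ⟨w, hw, hweq⟩ := attractor_pow_apply_generator A τ hτA g u hu hτg n
  obtain ⟨w', hw'⟩ := hw.exists_right_inv
  have hw0 : (w : K) ≠ 0 := by
    intro h
    have : ((w * w' : A) : K) = 0 := by push_cast; rw [h, zero_mul]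
    rw [hw'] at this
    simp at this
  have hwinv : (w : K)⁻¹ = (w' : K) := by
    apply inv_eq_of_mul_eq_one_right
    rw [← Subring.coe_mul, hw', Subring.coe_one]
  rw [ValuationSubring.mem_comap]
  change (τ ^ n) ((f : K) * ((g : K)⁻¹) ^ n) ∈ D
  rw [map_mul, map_pow, map_inv₀, haeq, hweq, mul_inv, mul_pow, inv_pow]
  have : (g : K) ^ n * (a : K) * (((g : K) ^ n)⁻¹ * (w : K)⁻¹ ^ n) = (a : K) * (w' : K) ^ n := by
    rw [← hwinv]
    field_simp
  rw [this, ← ValuationSubring.mem_toSubring]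
  exact D.toSubring.mul_mem (hAD a.2) (D.toSubring.pow_mem (hAD w'.2) n)

end Summit.ResolutionOfSingularities.ResolutionOfSingularities.Theorems
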